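/-
Copyright (c) 2026. All rights reserved.
Released under Apache 2.0 license as described in the file LICENSE.
Authors: abc-iut cell, prover seat abc-iut-w6-d031 (gen 5; PROOF-ONLY: «a limit at the cusp forces
trivial monodromy» — covering-space step of the cusp analysis (FC) of the [AbsTopIII] Prop 4.2 (i)
geometric column).
-/
import Literature.AnabelianGeometry.AbsoluteAnabelian.ArchimedeanHolFieldFunctorGeometricPSLCuspParabolic
import HarnessLib

/-!
# A limit at the cusp forces trivial monodromy

Classical covering-space step (H. M. Farkas, I. Kra, *Riemann Surfaces* (1992), IV.5.5–IV.5.6; the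
evenly covered neighbourhood argument, A. Hatcher, *Algebraic Topology*, §1.3 Prop. 1.34): let
`k : ℍ → X` be a covering map, `F̃ : ℍ → ℍ` continuous with `F̃ (τ + 1) = q • F̃ τ` for a `q` acting
through the fibres of `k` (`k (q • τ) = k τ`).  If `k ∘ F̃` CONVERGES to a point of `X` as
`Im τ → ∞`, then `q` fixes a point `F̃ τ` — hence `q = 1` when the deck group acts freely.  (On a
half-plane `{Im τ > A}` mapped into an evenly covered neighbourhood, the sheet index of `F̃ τ` is
locally constant, so `F̃ (τ + 1)` and `F̃ τ` lie on the same sheet over the same point.)  This is the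
converse companion of abc-iut-w6-d031's `HolRS.exists_parabolic_mem_of_end` (an END has non-trivial
monodromy) and the step «the cusp map of a parabolic element cannot converge inside `X`» of the cusp
analysis (FC).  PROOF-ONLY (no definitions, no named facts):

* ★ `HolRS.exists_smul_eq_self_of_tendsto` — the statement above;
* `HolRS.eq_one_of_tendsto` — with a free deck group (`IsCancelSMul Λ̄ ℍ`, `q ∈ Λ̄`): `q = 1`.

## References

* H. M. Farkas, I. Kra, *Riemann Surfaces*, 2nd ed. (1992), IV.5.5–IV.5.6. [FarkasKra1992]
* A. Hatcher, *Algebraic Topology* (2002), §1.3 Prop. 1.34. [HatcherAT2002]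
-/

set_option autoImplicit false

noncomputable section

open Complex Filter Topology Set Function
open scoped UpperHalfPlane

namespace Literature.AnabelianGeometry.AbsoluteAnabelian

namespace HolRS

/-- The half-planes `{τ ∈ ℍ | A < Im τ}` (`0 ≤ A`) are preconnected (images of convex subsets of
`ℂ`). [folklore] -/
private theorem isPreconnected_im_gt {A : ℝ} (hA : 0 ≤ A) :
    IsPreconnected {τ : ℍ | A < τ.im} := by
  -- the continuous parametrisation `{z : ℂ | A < z.im} → ℍ`
  have hsub : ∀ z : {z : ℂ // A < z.im}, 0 < (z : ℂ).im := fun z => lt_of_le_of_lt hA z.2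
  let φ : {z : ℂ // A < z.im} → ℍ := fun z => UpperHalfPlane.mk z (hsub z)
  have hφ : Continuous φ := by
    rw [UpperHalfPlane.isEmbedding_coe.continuous_iff]
    exact continuous_subtype_val
  have hconv : IsPreconnected (univ : Set {z : ℂ // A < z.im}) := by
    rw [← preconnectedSpace_iff_univ]
    exact Subtype.preconnectedSpace (convex_halfSpace_im_gt A).isPreconnected
  have himage : φ '' univ = {τ : ℍ | A < τ.im} := by
    ext τ
    constructor
    · rintro ⟨z, -, rfl⟩
      exact z.2
    · intro hτ
      exact ⟨⟨(τ : ℂ), by simpa using hτ⟩, mem_univ _, UpperHalfPlane.ext rfl⟩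
  rw [← himage]
  exact hconv.image φ hφ.continuousOn

/-- ★ **A limit at the cusp forces a fixed point of the monodromy.**  Let `k : ℍ → X` be a covering
map, `F̃ : ℍ → ℍ` continuous with `F̃ τ' = q • F̃ τ` whenever `τ' = τ + 1`, where `k (q • σ) = k σ` for
all `σ`.  If `k (F̃ τ)` converges in `X` as `Im τ → ∞`, then `q • F̃ τ = F̃ τ` for some `τ`
(evenly covered neighbourhood + local constancy of the sheet index on a half-plane).
[cite: FarkasKra1992, IV.5.5–IV.5.6] [cite: HatcherAT2002, §1.3 Prop. 1.34] -/
theorem exists_smul_eq_self_of_tendsto (X : HolRS) {k : ℍ → X.carrier} (hk : IsCoveringMap k)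
    {Ft : ℍ → ℍ} (hFt : Continuous Ft) {q : PSL2R} (hq : ∀ σ : ℍ, k (q • σ) = k σ)
    (hdeck : ∀ τ τ' : ℍ, (τ' : ℂ) = τ + 1 → Ft τ' = q • Ft τ) {x : X.carrier}
    (hlim : Tendsto (fun τ => k (Ft τ)) (comap UpperHalfPlane.im atTop) (𝓝 x)) :
    ∃ τ : ℍ, q • Ft τ = Ft τ := by
  classical
  -- an evenly covered neighbourhood `U` of `x`
  obtain ⟨hI, U, hxU, hU, hkU, H, hH⟩ := hk x
  -- a height `A ≥ 0` beyond which `k (F̃ τ) ∈ U`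
  have hmem : (fun τ => k (Ft τ)) ⁻¹' U ∈ comap UpperHalfPlane.im atTop := hlim (hU.mem_nhds hxU)
  obtain ⟨t, ht, hsub⟩ := mem_comap.mp hmem
  obtain ⟨A₀, hA₀⟩ := mem_atTop_sets.mp ht
  set A : ℝ := max A₀ 0 with hA
  have hin : ∀ τ : ℍ, A < τ.im → k (Ft τ) ∈ U := fun τ hτ =>
    hsub (hA₀ _ (le_of_lt (lt_of_le_of_lt (le_max_left _ _) hτ)))
  -- the translation
  let T : ℍ → ℍ := fun τ => UpperHalfPlane.mk ((τ : ℂ) + 1) (by simpa using τ.im_pos)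
  have hT : ∀ τ : ℍ, Ft (T τ) = q • Ft τ := fun τ => hdeck τ (T τ) rfl
  have hTim : ∀ τ : ℍ, (T τ).im = τ.im := fun τ => by
    show ((τ : ℂ) + 1).im = τ.im
    simp
  -- a base point at height `A + 1`
  let τ₀ : ℍ := UpperHalfPlane.mk (((A + 1 : ℝ) : ℂ) * I) (by simp; linarith [le_max_right A₀ 0])
  have hτ₀ : A < τ₀.im := by
    show A < ((((A + 1 : ℝ) : ℂ) * I).im)
    simp
  -- the sheet index, defined on all of `ℍ` (junk outside the half-plane)
  let i₀ : _ := (H ⟨Ft τ₀, hin τ₀ hτ₀⟩).2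
  let g : ℍ → _ := fun τ => if h : k (Ft τ) ∈ U then (H ⟨Ft τ, h⟩).2 else i₀
  have hg : ∀ (τ : ℍ) (h : k (Ft τ) ∈ U), g τ = (H ⟨Ft τ, h⟩).2 := fun τ h => by
    simp only [g, dif_pos h]
  -- `g` is continuous on the half-plane (restriction = `H.2 ∘ F̃`)
  haveI := hI
  have hgc : ContinuousOn g {τ : ℍ | A < τ.im} := by
    rw [continuousOn_iff_continuous_restrict]
    have h1 : Continuous fun τ : {τ : ℍ | A < τ.im} => (H ⟨Ft τ, hin τ τ.2⟩).2 :=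
      continuous_snd.comp (H.continuous.comp ((hFt.comp continuous_subtype_val).subtype_mk _))
    refine h1.congr fun τ => ?_
    show (H ⟨Ft τ, hin τ τ.2⟩).2 = g τ
    rw [hg τ (hin τ τ.2)]
  -- hence constant there
  have hconst : ∀ τ : ℍ, A < τ.im → g τ = g τ₀ := fun τ hτ =>
    (isPreconnected_im_gt (le_max_right A₀ 0)).constant hgc hτ hτ₀
  -- at `τ₀`: `F̃ (T τ₀)` and `F̃ τ₀` have the same image under `H`
  have hTτ₀ : A < (T τ₀).im := by rw [hTim]; exact hτ₀
  have hkeq : k (Ft (T τ₀)) = k (Ft τ₀) := by rw [hT, hq]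
  have hHeq : H ⟨Ft (T τ₀), hin _ hTτ₀⟩ = H ⟨Ft τ₀, hin _ hτ₀⟩ := by
    apply Prod.ext
    · apply Subtype.ext
      rw [hH, hH]
      exact hkeq
    · rw [← hg _ (hin _ hTτ₀), ← hg _ (hin _ hτ₀)]
      exact (hconst _ hTτ₀).trans (hconst _ hτ₀).symm
  have heq : Ft (T τ₀) = Ft τ₀ := by
    have := H.injective hHeq
    exact congrArg Subtype.val this
  exact ⟨τ₀, by rw [← hT, heq]⟩

/-- **With a free deck group the monodromy is trivial**: in the situation of
`exists_smul_eq_self_of_tendsto`, if `q` lies in a subgroup `Λ̄` acting freely on `ℍ`, then `q = 1`.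
[cite: FarkasKra1992, IV.5.5–IV.5.6] -/
theorem eq_one_of_tendsto (X : HolRS) {k : ℍ → X.carrier} (hk : IsCoveringMap k)
    (Λ : Subgroup PSL2R) [IsCancelSMul Λ ℍ] {Ft : ℍ → ℍ} (hFt : Continuous Ft) {q : PSL2R}
    (hqΛ : q ∈ Λ) (hq : ∀ σ : ℍ, k (q • σ) = k σ)
    (hdeck : ∀ τ τ' : ℍ, (τ' : ℂ) = τ + 1 → Ft τ' = q • Ft τ) {x : X.carrier}
    (hlim : Tendsto (fun τ => k (Ft τ)) (comap UpperHalfPlane.im atTop) (𝓝 x)) : q = 1 := by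
  obtain ⟨τ, hτ⟩ := exists_smul_eq_self_of_tendsto X hk hFt hq hdeck hlim
  have hfix : (⟨q, hqΛ⟩ : Λ) • Ft τ = Ft τ := hτ
  have := IsCancelSMul.eq_one_of_smul hfix
  exact congrArg Subtype.val this

end HolRS

end Literature.AnabelianGeometry.AbsoluteAnabelian

end
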